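import Mathlib
import Summits.Ventures.PercRepro2.CrossAPrimeCoinMarkDebt

/-!
# The coin at a mark, V: the refined debt bound (D2a) — the grown `b`-row counts twice
(blind cell PercRepro2, p5 g39; `proofs/subclaims/S4-HARDSTEP.md` §2.4 (s) addendum 50)

The debt bound (D1b) of `CrossAPrimeCoinMarkDebt` credits the grown mass `yv₂′ = P¹(Q, vL, bH, type 2)`
with the coefficient `Z⁰`; it is FALSE in general (exact witnesses, addendum 50 (2)).  The exact
identity of that file credits it with `2Z⁰ − x⁰ − Z₂′ = Z⁰ + P⁰(Q, o ∈ A)` (the `r₁`-row with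
`2Z⁰ − x⁰ − Z₂′`, the `r₂`-row with `2Z⁰ − x⁰`), and the REFINED DEBT BOUND

  **(D2a)**  `Z₂′ · P⁰(Q, vL, bH, a₁ ↔ o) ≤ y⁰ · (c·Z₂′ − Zv₂′) + (2Z⁰ − x⁰ − Z₂′) · yv₂′`

is exactly `CROSS ≥ 0` with the three payments `y₂′(c·x⁰ − xv⁰)`, `Z₂′·Dv⁰`, `r₂·Z₂′` dropped.
Census-true (0 / 19,200 and 0 / 5,765 exact instances; 423 adversarial climbs, tie wall at `0`)
and NOT claimed here: **`cross_nonneg_of_debt_bound'`**, **`a2Step_coin_mark_of_debt_bound'`**.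
Own work; standard axioms.
-/

namespace Summit.Ventures.PercRepro2

open LeafRowPendantRootSO CrossAPrimeSupport CrossAPrimeA2Route CrossAPrimeA2Induction
  CrossAPrimeExploredBound CrossAPrimeA2VEdge CrossAPrimeCoinMark CrossAPrimeCoinMarkDebt

namespace CrossAPrimeCoinMarkDebt2

section Main

variable {V : Type*} {E : Type*} [Fintype E] [DecidableEq E] [Fintype V] [DecidableEq V]
  {R : Type*} [Field R] [LinearOrder R] [IsStrictOrderedRing R]
variable {ends : E → Sym2 V}

omit [DecidableEq V] in
/-- **`CROSS ≥ 0` from the refined debt bound (D2a)**: along the coin `e = {a₂, o}` (random, `c`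
admissible), if `Z₂′ · P⁰(Q, vL, bH, a₁ ↔ o) ≤ y⁰ · (c·Z₂′ − Zv₂′) + (2Z⁰ − x⁰ − Z₂′) · yv₂′`, the
growth term `CROSS` of `coin_mark_mid_eq` is nonnegative. -/
theorem cross_nonneg_of_debt_bound' {p : E → R} (hp : IsProbVec p) {c : R} {a₁ a₂ v : V}
    (hadm : Adm p c ends a₁ a₂ v) {e : E} {o : V} (hends : ends e = s(a₂, o)) (h1 : p e ≠ 1)
    (b : V)
    (hdebt : prob (Function.update p e 1) (avoidAll ends a₂ {a₁} ∩
          {ω | o ∉ cluster ends (Function.update ω e false) a₂}) *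
        prob (Function.update p e 0) ((avoidAll ends a₂ {a₁} ∩
          (connEvent ends a₁ v ∩ connEvent ends a₂ b)) ∩ connEvent ends a₁ o) ≤
      prob (Function.update p e 0) (avoidAll ends a₂ {a₁} ∩ connEvent ends a₂ b) *
          (c * prob (Function.update p e 1) (avoidAll ends a₂ {a₁} ∩
              {ω | o ∉ cluster ends (Function.update ω e false) a₂}) -
            prob (Function.update p e 1) ((avoidAll ends a₂ {a₁} ∩ connEvent ends a₁ v) ∩
              {ω | o ∉ cluster ends (Function.update ω e false) a₂})) +
        (2 * prob (Function.update p e 0) (avoidAll ends a₂ {a₁}) -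
            prob (Function.update p e 0) (avoidAll ends a₂ {a₁} ∩ connEvent ends a₂ o) -
            prob (Function.update p e 1) (avoidAll ends a₂ {a₁} ∩
              {ω | o ∉ cluster ends (Function.update ω e false) a₂})) *
          prob (Function.update p e 1)
            ((avoidAll ends a₂ {a₁} ∩ (connEvent ends a₁ v ∩ connEvent ends a₂ b)) ∩
              {ω | o ∉ cluster ends (Function.update ω e false) a₂})) :
    0 ≤
      prob (Function.update p e 1) ((avoidAll ends a₂ {a₁} ∩ connEvent ends a₂ b) ∩
            {ω | o ∉ cluster ends (Function.update ω e false) a₂}) *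
          (c * prob (Function.update p e 0) (avoidAll ends a₂ {a₁} ∩ connEvent ends a₂ o) -
            prob (Function.update p e 0)
              (avoidAll ends a₂ {a₁} ∩ (connEvent ends a₁ v ∩ connEvent ends a₂ o))) +
        prob (Function.update p e 0) (avoidAll ends a₂ {a₁} ∩ connEvent ends a₂ b) *
          (c * prob (Function.update p e 1) (avoidAll ends a₂ {a₁} ∩
              {ω | o ∉ cluster ends (Function.update ω e false) a₂}) -
            prob (Function.update p e 1) ((avoidAll ends a₂ {a₁} ∩ connEvent ends a₁ v) ∩
              {ω | o ∉ cluster ends (Function.update ω e false) a₂})) +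
        prob (Function.update p e 1)
            ((avoidAll ends a₂ {a₁} ∩ (connEvent ends a₁ v ∩ connEvent ends a₂ b)) ∩
              {ω | o ∉ cluster ends (Function.update ω e false) a₂}) *
          (2 * prob (Function.update p e 0) (avoidAll ends a₂ {a₁}) -
            prob (Function.update p e 0) (avoidAll ends a₂ {a₁} ∩ connEvent ends a₂ o)) +
        prob (Function.update p e 1) (avoidAll ends a₂ {a₁} ∩
            {ω | o ∉ cluster ends (Function.update ω e false) a₂}) *
          (2 * prob (Function.update p e 0) (avoidAll ends a₂ {a₁} ∩
              (connEvent ends a₁ v ∩ (connEvent ends a₂ o ∩ connEvent ends a₂ b))) -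
            prob (Function.update p e 0)
              (avoidAll ends a₂ {a₁} ∩ (connEvent ends a₁ v ∩ connEvent ends a₂ b))) := by
  have hp0 : IsProbVec (Function.update p e 0) := hp.update e le_rfl zero_le_one
  have hp1 : IsProbVec (Function.update p e 1) := hp.update e zero_le_one le_rfl
  have hadm0 : Adm (Function.update p e 0) c ends a₁ a₂ v :=
    adm_update_zero hadm ⟨a₂, mem_cluster_self ends _ a₂, o, hends⟩ h1
  -- the admissibility bound `xv⁰ ≤ c·x⁰`
  have hx : prob (Function.update p e 0)
      (avoidAll ends a₂ {a₁} ∩ (connEvent ends a₁ v ∩ connEvent ends a₂ o)) ≤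
      c * prob (Function.update p e 0) (avoidAll ends a₂ {a₁} ∩ connEvent ends a₂ o) := by
    have h := prob_Q_vL_le_mul hp0 hadm0 {A : Set V | o ∈ A}
    rw [← connEvent_eq_clusterInEvent'] at h
    have e1 : connEvent ends a₂ o ∩ connEvent ends a₁ v ∩ avoidAll ends a₂ {a₁} =
        avoidAll ends a₂ {a₁} ∩ (connEvent ends a₁ v ∩ connEvent ends a₂ o) := by
      ext ω; simp only [Set.mem_inter_iff]; tauto
    have e2 : connEvent ends a₂ o ∩ avoidAll ends a₂ {a₁} =
        avoidAll ends a₂ {a₁} ∩ connEvent ends a₂ o := Set.inter_comm _ _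
    rw [e1, e2] at h
    exact h
  -- the two splits
  have s0 := yv0_split (Function.update p e 0) (ends := ends) a₁ a₂ o v b
  have s2 := yv2_split p (ends := ends) e a₁ a₂ o v b
  rw [r1_eq p hends a₁ v b] at s2
  -- nonnegativity of the masses
  have hy2 := prob_nonneg hp1 ((avoidAll ends a₂ {a₁} ∩ connEvent ends a₂ b) ∩
    {ω | o ∉ cluster ends (Function.update ω e false) a₂})
  have hZ2' := prob_nonneg hp1 (avoidAll ends a₂ {a₁} ∩
    {ω | o ∉ cluster ends (Function.update ω e false) a₂})
  have hDv := prob_nonneg hp0 (avoidAll ends a₂ {a₁} ∩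
    (connEvent ends a₁ v ∩ (connEvent ends a₂ o ∩ connEvent ends a₂ b)))
  have hr2 := prob_nonneg hp1 (((avoidAll ends a₂ {a₁} ∩
    (connEvent ends a₁ v ∩ connEvent ends a₂ b)) ∩
      {ω | o ∉ cluster ends (Function.update ω e false) a₂}) ∩
    {ω | Conn ends (Function.update ω e false) a₂ b}ᶜ)
  -- the three dropped payments
  have k1 := mul_nonneg hy2 (sub_nonneg.2 hx)
  have k2 := mul_nonneg hZ2' hDv
  have k3 := mul_nonneg hr2 hZ2'
  nlinarith [k1, k2, k3, hdebt, s0, s2]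

omit [DecidableEq V] in
/-- **The coin at a mark from (D2a)**: under the induction hypothesis `0 ≤ crossC(p⁰; c)` and the
refined debt bound, the middle coefficient along `e = {a₂, o}` is nonnegative. -/
theorem a2Step_coin_mark_of_debt_bound' {p : E → R} (hp : IsProbVec p) {c : R} {a₁ a₂ v : V}
    (hadm : Adm p c ends a₁ a₂ v) {e : E} {o : V} (hends : ends e = s(a₂, o)) (h1 : p e ≠ 1)
    (b : V) (hIH : 0 ≤ crossC (Function.update p e 0) c ends o a₁ a₂ v b)
    (hdebt : prob (Function.update p e 1) (avoidAll ends a₂ {a₁} ∩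
          {ω | o ∉ cluster ends (Function.update ω e false) a₂}) *
        prob (Function.update p e 0) ((avoidAll ends a₂ {a₁} ∩
          (connEvent ends a₁ v ∩ connEvent ends a₂ b)) ∩ connEvent ends a₁ o) ≤
      prob (Function.update p e 0) (avoidAll ends a₂ {a₁} ∩ connEvent ends a₂ b) *
          (c * prob (Function.update p e 1) (avoidAll ends a₂ {a₁} ∩
              {ω | o ∉ cluster ends (Function.update ω e false) a₂}) -
            prob (Function.update p e 1) ((avoidAll ends a₂ {a₁} ∩ connEvent ends a₁ v) ∩
              {ω | o ∉ cluster ends (Function.update ω e false) a₂})) +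
        (2 * prob (Function.update p e 0) (avoidAll ends a₂ {a₁}) -
            prob (Function.update p e 0) (avoidAll ends a₂ {a₁} ∩ connEvent ends a₂ o) -
            prob (Function.update p e 1) (avoidAll ends a₂ {a₁} ∩
              {ω | o ∉ cluster ends (Function.update ω e false) a₂})) *
          prob (Function.update p e 1)
            ((avoidAll ends a₂ {a₁} ∩ (connEvent ends a₁ v ∩ connEvent ends a₂ b)) ∩
              {ω | o ∉ cluster ends (Function.update ω e false) a₂})) :
    0 ≤ crossPatC (Function.update p e 0) (Function.update p e 1) c ends o a₁ a₂ v b +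
        crossPatC (Function.update p e 1) (Function.update p e 0) c ends o a₁ a₂ v b :=
  a2Step_coin_mark_of_cross hp hadm hends h1 b hIH
    (cross_nonneg_of_debt_bound' hp hadm hends h1 b hdebt)

end Main

end CrossAPrimeCoinMarkDebt2

end Summit.Ventures.PercRepro2
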